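import Summits.CriticalPhenomena.PercolationContinuityZ3.Theorems.Transplant.PlanarSkeletonFrm1
import Summits.CriticalPhenomena.PercolationContinuityZ3.Theorems.Transplant.PlanarSkeletonNegFromDefs
import HarnessLib

/-!
# The universal one-type node of the skeleton ladder: `PlanarSkeletonFrmFrom` = frames only (no point symmetry) AND cylinders connected only
# from some width `ℓ₀` on; the drop node `SamePDropOfSkeletonFrmFrom₁` over it (`@[conjecture]`, OPEN, never asserted)

builds on p205010 (kernel theorem, internal audit signed; external expert review pending) — nothing in this file uses p205010; NOTHING is claimed
about any node (N2 `SamePDropOfSkeletonFrm₁`, D″(κ′) `SamePDropOfSkeletonNegFrom₁` and the node typed here are OPEN `Prop`s of this programme).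
Lane `prim-bschramm`, seat `prim-bschramm-p4` gen 13 (PART C3 of `P4-GENERAL.md` §35: INPUT(G) as weak as possible).  Helper file
(`--supports stmt-CriticalPhenomena-4575 --as helper`).  DEFINITIONS + immediate reductions only.

WHY (P4-GENERAL §35.3–§35.4).  The lineage's interface ladder for `θ(p_c) = 0` has two independent weakenings of the closed one-type `{±1}` node
`SamePDropOfSkeletonNeg₁` (p329520): delete the inversion (N2, `PlanarSkeletonFrm`, stmt-g18 — in typing by the lane) and weaken (κ) "every cylinder
of half-width `ℓ ≥ 1` connected" to (κ′) "connected from some `ℓ₀` on" (D″(κ′), `PlanarSkeletonNegFrom`, p4 gen 12 — (κ) fails for the letters-only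
free nilpotent groups of class `≥ 4` under EVERY flat chart, §35.2, while (κ′) holds for every finitely generated kernel).  Both weakenings are
re-parametrisations of the same proof ((κ′): a φ-level wave over the `hκ : Skelφ.CylConn` binder of ≤ 148 dictionary files, four consumers,
§35.3).  This file types their MEET, the end of the ladder for one-type carriers:
* `PlanarSkeletonFrmFrom G` — `PlanarSkeletonFrm` (8 fields) with the width field `ℓ₀` and (κ′) `cyl_connected : ∀ t ∈ types, ∀ ℓ ≥ ℓ₀, …`;
  `cyl`, `CylSubcritical` verbatim; forgetful maps `PlanarSkeletonFrm.toFrmFrom` (`ℓ₀ = 1`), `PlanarSkeletonNegFrom.toFrmFrom` (drop `neg`);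
* **`SamePDropOfSkeletonFrmFrom₁`** (OPEN): the one-type drop node over it — same body as `SamePDropOfSkeletonFrm₁` / `SamePDropOfSkeletonNegFrom₁`;
  it implies BOTH (`samePDropOfSkeletonFrm₁_of_frmFrom₁`, `samePDropOfSkeletonNegFrom₁_of_frmFrom₁`), hence N1's statement; normal form
  `…_iff_critical`; the customers' one-liner `continuity_of_frmFromNode₁` (one type, `G` connected, Φ2 at `p_c` ⟹ `θ_t(p_c) = 0`; uniqueness by
  the Hutchcroft / Burton–Keane split, `p_c < 1` by the steps).
CUSTOMERS (file `CayleySkeletonFrmFrom`, conditional on this node): every `Cay(Γ;S)` with an additive unit-range chart with unit steps and a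
finitely generated kernel — NO automorphism, NO cylinder condition; in particular every finitely generated nilpotent group with letters-type
generators (`NilFrm.Data`).
[cite: KozmaNitzan2024, §1 p. 2 (approach 1); §4 pp. 15–17 (Lemma 8, the role of the lattice symmetries)] [cite: BenjaminiSchramm1996, Conj. 4]
[cite: MartineauTassion2017, §3.2]
-/

noncomputable section

namespace Summit.CriticalPhenomena.PercolationContinuityZ3.Theorems.Transplant

open MeasureTheory Literature.Probability.Percolation Literature.Probability.LatticeModels
open Literature.Barriers.CriticalPhenomena (IsQuasiTransitive IsGraphAmenable HasExponentialGrowth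
  hasExponentialGrowth_of_not_isGraphAmenable Hutchcroft2016_noPercolationAtCriticality_holds BurtonKeane1989_atMostOneInfiniteCluster_holds
  countable_of_connected_of_locallyFinite)
open scoped Classical

/-- **Planar skeleton with translating frames only and cylinders connected FROM SOME WIDTH ON** (interface of the universal one-type node):
`PlanarSkeletonFrm` with (κ) replaced by (κ′) `∀ ℓ ≥ ℓ₀, cylinders connected` (the width `ℓ₀` is a field); no point symmetry.
[cite: KozmaNitzan2024, §4 p. 16 (Lemma 8)] [cite: MartineauTassion2017, §3.2] -/
structure PlanarSkeletonFrmFrom {V : Type} (G : SimpleGraph V) [G.LocallyFinite] where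
  /-- the skeleton map `φ : V → ℤ²` -/
  φ : V → Site 2
  /-- `φ` is 1-Lipschitz in the sup-norm along edges -/
  lip : ∀ ⦃u v : V⦄, G.Adj u v → ∀ i : Fin 2, |φ u i - φ v i| ≤ 1
  /-- finitely many base vertices (one per frame type) -/
  types : Finset V
  /-- FRAMES: every vertex is the image of a base vertex under an automorphism translating the skeleton -/
  frame : ∀ v : V, ∃ t ∈ types, ∃ α : G ≃g G, α t = v ∧ ∀ w, φ (α w) = φ w + (φ v - φ t)
  /-- (μ) a degree bound -/
  Δ : ℕ
  /-- every vertex has degree `≤ Δ` -/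
  degree_le : ∀ v : V, G.degree v ≤ Δ
  /-- (ι) outward unit steps in every skeleton direction at every vertex -/
  step : ∀ (v : V) (i : Fin 2) (σ : ℤˣ), ∃ v' : V, G.Adj v v' ∧ φ v' = φ v + Pi.single i (σ : ℤ)
  /-- (κ′) the width from which on cylinders are connected -/
  ℓ₀ : ℕ
  /-- (κ′) the graph induced on each cylinder of half-width `ℓ ≥ ℓ₀` at a base vertex is connected -/
  cyl_connected : ∀ t ∈ types, ∀ ℓ : ℕ, ℓ₀ ≤ ℓ → (G.induce {w | φ w - φ t ∈ box 2 ℓ}).Connected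

namespace PlanarSkeletonFrmFrom

variable {V : Type} {G : SimpleGraph V} [G.LocallyFinite] (Φ : PlanarSkeletonFrmFrom G)

/-- Cylinder of half-width `ℓ` at `t`. [cite: KozmaNitzan2024, §4 p. 15 (boxes)] -/
def cyl (t : V) (ℓ : ℕ) : Set V := {w | Φ.φ w - Φ.φ t ∈ box 2 ℓ}

/-- **Input Φ2 at density `p`**: the induced graph of every cylinder (EVERY width) at a base vertex has `θ = 0` at `p`.
[cite: MartineauSevero2019, Cor. 2.2] -/
def CylSubcritical (p : unitInterval) : Prop :=
  ∀ t ∈ Φ.types, ∀ ℓ : ℕ,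
    theta (G.induce (Φ.cyl t ℓ)) ⟨t, show Φ.φ t - Φ.φ t ∈ box 2 ℓ by rw [sub_self]; exact zero_mem_box 2 ℓ⟩ p = 0

/-- Frames with finitely many types make a `PlanarSkeletonFrmFrom` graph quasi-transitive (the inverse frame carries `v` into `types`).
[cite: Hutchcroft2016, §1 (finitely many Aut(G)-orbits)] -/
theorem isQuasiTransitive_frmFrom (Φ : PlanarSkeletonFrmFrom G) : IsQuasiTransitive G :=
  ⟨Φ.types, fun v => by
    obtain ⟨t, ht, α, hαt, -⟩ := Φ.frame v
    exact ⟨α.symm, by rw [← hαt, RelIso.symm_apply_apply]; exact ht⟩⟩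

/-- `p_c < 1` at every vertex of a connected `PlanarSkeletonFrmFrom` graph (from the steps alone). [cite: BenjaminiSchramm1996, Thm. 1] -/
theorem criticalProb_lt_one_frmFrom (Φ : PlanarSkeletonFrmFrom G) (hc : G.Connected) (t : V) : criticalProb G t < 1 :=
  haveI : Countable V := countable_of_connected_of_locallyFinite G hc t
  Skelφ.criticalProb_lt_one_of_steps (φ := Φ.φ) Φ.step t

end PlanarSkeletonFrmFrom

namespace PlanarSkeletonFrm

variable {V : Type} {G : SimpleGraph V} [G.LocallyFinite] (Φ : PlanarSkeletonFrm G)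

/-- **Every `PlanarSkeletonFrm` is a `PlanarSkeletonFrmFrom`** with `ℓ₀ = 1`. [folklore] -/
def toFrmFrom : PlanarSkeletonFrmFrom G where
  φ := Φ.φ
  lip := Φ.lip
  types := Φ.types
  frame := Φ.frame
  Δ := Φ.Δ
  degree_le := Φ.degree_le
  step := Φ.step
  ℓ₀ := 1
  cyl_connected := Φ.cyl_connected

/-- The base vertices of `toFrmFrom` are those of the skeleton. [folklore] -/
@[simp] theorem toFrmFrom_types : Φ.toFrmFrom.types = Φ.types := rfl

/-- The cylinders of `toFrmFrom` are those of the skeleton. [folklore] -/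
@[simp] theorem toFrmFrom_cyl (t : V) (ℓ : ℕ) : Φ.toFrmFrom.cyl t ℓ = Φ.cyl t ℓ := rfl

/-- Cylinder subcriticality is the same statement for `toFrmFrom`. [folklore] -/
theorem cylSubcritical_toFrmFrom_iff (p : unitInterval) : Φ.toFrmFrom.CylSubcritical p ↔ Φ.CylSubcritical p := Iff.rfl

end PlanarSkeletonFrm

namespace PlanarSkeletonNegFrom

variable {V : Type} {G : SimpleGraph V} [G.LocallyFinite] (Φ : PlanarSkeletonNegFrom G)

/-- **Every `PlanarSkeletonNegFrom` is a `PlanarSkeletonFrmFrom`** (drop the inversion, keep `ℓ₀`). [folklore] -/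
def toFrmFrom : PlanarSkeletonFrmFrom G where
  φ := Φ.φ
  lip := Φ.lip
  types := Φ.types
  frame := Φ.frame
  Δ := Φ.Δ
  degree_le := Φ.degree_le
  step := Φ.step
  ℓ₀ := Φ.ℓ₀
  cyl_connected := Φ.cyl_connected

/-- The base vertices of `toFrmFrom` are those of the skeleton. [folklore] -/
@[simp] theorem toFrmFrom_types : Φ.toFrmFrom.types = Φ.types := rfl

/-- The cylinders of `toFrmFrom` are those of the skeleton. [folklore] -/
@[simp] theorem toFrmFrom_cyl (t : V) (ℓ : ℕ) : Φ.toFrmFrom.cyl t ℓ = Φ.cyl t ℓ := rfl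

/-- Cylinder subcriticality is the same statement for `toFrmFrom`. [folklore] -/
theorem cylSubcritical_toFrmFrom_iff (p : unitInterval) : Φ.toFrmFrom.CylSubcritical p ↔ Φ.CylSubcritical p := Iff.rfl

end PlanarSkeletonNegFrom

/-- TARGET (OPEN — a `Prop`, never asserted; NOT in print): **THE UNIVERSAL ONE-TYPE NODE** — the drop node over skeletons with translating frames
only (no point symmetry) whose cylinders are connected only from some width `ℓ₀` on.  For every connected, locally finite, countable `G` with a
`PlanarSkeletonFrmFrom` having ONE base vertex type `t`, every `p < 1` with a.s. uniqueness, subcritical cylinders and `θ_t(p) > 0` there is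
`q < p` with `θ_t(q) > 0`.  It implies the frames-only node N2 (`samePDropOfSkeletonFrm₁_of_frmFrom₁`) and the node variant D″(κ′)
(`samePDropOfSkeletonNegFrom₁_of_frmFrom₁`); the converses are its open content.  Intended proof: an N2 closure with every consumed cylinder width
raised to `max(·, ℓ₀)` (the (κ′) wave of P4-GENERAL §35.3). [cite: KozmaNitzan2024, §1 p. 2 (approach 1), §4 pp. 15–31]
[cite: BenjaminiSchramm1996, Conj. 4] [cite: MartineauTassion2017, §3.2] -/
@[conjecture] def SamePDropOfSkeletonFrmFrom₁ : Prop :=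
  ∀ {V : Type} [DecidableEq V] [Countable V] (G : SimpleGraph V) [G.LocallyFinite] (Φ : PlanarSkeletonFrmFrom G),
    G.Connected → ∀ t ∈ Φ.types, Φ.types = {t} → ∀ p : unitInterval, (p : ℝ) < 1 →
      (∀ᵐ ω ∂bondPercolation G p, numInfiniteClusters ω ≤ 1) → Φ.CylSubcritical p → 0 < theta G t p →
        ∃ q : unitInterval, (q : ℝ) < p ∧ 0 < theta G t q

/-- **The universal node implies the frames-only node N2** (forget that `ℓ₀ = 1`). [folklore] -/
theorem samePDropOfSkeletonFrm₁_of_frmFrom₁ (h : SamePDropOfSkeletonFrmFrom₁) : SamePDropOfSkeletonFrm₁ :=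
  fun G _ Φ hc t ht h1 p hp hU hC hθ => h G Φ.toFrmFrom hc t (by rwa [PlanarSkeletonFrm.toFrmFrom_types])
    (by rw [PlanarSkeletonFrm.toFrmFrom_types, h1]) p hp hU ((PlanarSkeletonFrm.cylSubcritical_toFrmFrom_iff Φ p).2 hC) hθ

/-- **The universal node implies the node variant D″(κ′)** (forget the inversion). [folklore] -/
theorem samePDropOfSkeletonNegFrom₁_of_frmFrom₁ (h : SamePDropOfSkeletonFrmFrom₁) : SamePDropOfSkeletonNegFrom₁ :=
  fun G _ Φ hc t ht h1 p hp hU hC hθ => h G Φ.toFrmFrom hc t (by rwa [PlanarSkeletonNegFrom.toFrmFrom_types])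
    (by rw [PlanarSkeletonNegFrom.toFrmFrom_types, h1]) p hp hU ((PlanarSkeletonNegFrom.cylSubcritical_toFrmFrom_iff Φ p).2 hC) hθ

/-- **The universal node implies the CLOSED one-type `{±1}` node's statement** (through either intermediate node). [folklore] -/
theorem samePDropOfSkeletonNeg₁_of_frmFrom₁ (h : SamePDropOfSkeletonFrmFrom₁) : SamePDropOfSkeletonNeg₁ :=
  samePDropOfSkeletonNeg₁_of_negFrom₁ (samePDropOfSkeletonNegFrom₁_of_frmFrom₁ h)

/-- **Normal form at criticality**: the universal node has content at `p = p_c` only. [cite: BenjaminiSchramm1996, Conj. 4] -/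
theorem samePDropOfSkeletonFrmFrom₁_iff_critical : SamePDropOfSkeletonFrmFrom₁ ↔
    ∀ {V : Type} [DecidableEq V] [Countable V] (G : SimpleGraph V) [G.LocallyFinite] (Φ : PlanarSkeletonFrmFrom G),
      G.Connected → ∀ t ∈ Φ.types, Φ.types = {t} → criticalProb G t < 1 →
        (∀ᵐ ω ∂bondPercolation G (criticalProbIOf G t), numInfiniteClusters ω ≤ 1) →
          Φ.CylSubcritical (criticalProbIOf G t) → theta G t (criticalProbIOf G t) = 0 := by
  constructor
  · intro hD V _ _ G _ Φ hc t ht h1 hpc hU hC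
    exact theta_criticalProbIOf_eq_zero_of_drop_at G t fun hpos => hD G Φ hc t ht h1 _ (by exact hpc) hU hC hpos
  · intro hK V _ _ G _ Φ hc t ht h1 p hp1 hU hC hθ
    have hge : criticalProb G t ≤ p :=
      not_lt.1 fun hlt => hθ.ne' (theta_eq_zero_of_lt_criticalProb_holds G t p hlt)
    rcases hge.lt_or_eq with hlt | heq
    · have hpc0 : 0 ≤ criticalProb G t := (criticalProb_mem_Icc G t).1
      have hp0 : 0 ≤ (p : ℝ) := p.2.1
      have hq1 : (criticalProb G t + p) / 2 ≤ 1 := by linarith [p.2.2]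
      refine ⟨⟨(criticalProb G t + p) / 2, by positivity, hq1⟩, ?_, ?_⟩
      · show (criticalProb G t + (p : ℝ)) / 2 < p
        linarith
      · exact theta_pos_of_criticalProb_lt_holds G t _
          (by show criticalProb G t < (criticalProb G t + (p : ℝ)) / 2; linarith)
    · exfalso
      have e : p = criticalProbIOf G t := Subtype.ext heq.symm
      subst e
      exact hθ.ne' (hK G Φ hc t ht h1 (by exact hp1) hU hC)

/-- **Conditional continuity from the universal node** (the customers' one-liner): on a connected locally finite graph with a one-type
`PlanarSkeletonFrmFrom` and subcritical cylinders at `p_c`, `θ_t(p_c) = 0` — countability, quasi-transitivity, uniqueness (Hutchcroft off amenability,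
Burton–Keane on it) and `p_c < 1` come from the skeleton. [cite: BenjaminiSchramm1996, Conj. 4] [cite: Hutchcroft2016, Thm. 1] [cite: LyonsPeres2016, Thm. 7.6] -/
theorem continuity_of_frmFromNode₁ (hD : SamePDropOfSkeletonFrmFrom₁) {V : Type} (G : SimpleGraph V) [G.LocallyFinite]
    (Φ : PlanarSkeletonFrmFrom G) (hc : G.Connected) (t : V) (ht : t ∈ Φ.types) (h1 : Φ.types = {t})
    (hC : Φ.CylSubcritical (criticalProbIOf G t)) : theta G t (criticalProbIOf G t) = 0 := by
  haveI : Countable V := countable_of_connected_of_locallyFinite G hc t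
  have hq : IsQuasiTransitive G := Φ.isQuasiTransitive_frmFrom
  by_cases hg : HasExponentialGrowth G
  · exact Hutchcroft2016_noPercolationAtCriticality_holds G hc hq hg t
  · have ha : IsGraphAmenable G := by_contra fun hna => hg (hasExponentialGrowth_of_not_isGraphAmenable G hq hna)
    exact samePDropOfSkeletonFrmFrom₁_iff_critical.1 hD G Φ hc t ht h1 (Φ.criticalProb_lt_one_frmFrom hc t)
      (BurtonKeane1989_atMostOneInfiniteCluster_holds G hc hq ha _) hC

end Summit.CriticalPhenomena.PercolationContinuityZ3.Theorems.Transplant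

end
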